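import Summits.KontsevichZagierPeriods.KontsevichZagierPeriods.Theorems.LinRedNormalFormArrangementNormalFormSeparateThreeHHKMonoSplit
import Summits.KontsevichZagierPeriods.KontsevichZagierPeriods.Theorems.LinRedNormalFormArrangementNormalFormSeparateThreeHHKOrder

/-!
# One-variable splits and sweeps inside triple integrals

(Line `janus-bands`, crux `ArrangementNormalForm`, stub `stub_separateHigh`, part `HHKSplit` of
the wall-invariant termwise-split lemma `separateThree_hHk` in base dimension `3` with fibres.)
The ray theorems on a nested thin sector (blown-up coordinates `(t, v, u)`, weight `W` almost
decreasing towards the corner at ratio `4`, with logarithmic contraction costs in the FREE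
variables) use two elementary moves on iterated integrals `∫⁻_t ∫⁻_v ∫⁻_u`:
* SPLITS (`split_u_lt_top`, `split_v_lt_top`, `split_t_lt_top`, the last registered as
  `separateThreeHHK_split`): if a polynomial IN ONE OF THE VARIABLES, with coefficients depending
  measurably on the two others, is absolutely `W`-integrable on the big box, then so is each of
  its monomials on the small box — the quantitative one-variable split `SepHHK.monoSplit₁_le`
  (part `HHKMonoSplit`) applied pointwise, and Tonelli (`SepHHK.iter_swap12/23`);
* SWEEPS (`sweep_u_lt_top`, `sweep_v_lt_top`): with a logarithmic cost in `u` (resp. `v`),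
  integrability over the dyadic range `(η/2, η)` implies integrability over `(0, η)`
  (`SepTwo.lintegral_le_of_logmono`, part `Angular`, applied pointwise).
Also `lower_box_lt_top`: a lower bound `h ≤ |H|` on a sub-box turns the integrability of
`|H| · F · W` into that of `F · W` there.
-/

noncomputable section

open Set MeasureTheory
open scoped ENNReal

namespace Summit.KontsevichZagierPeriods.ArrangementNormalForm.JanusBands

namespace SepHHK

open SepTwo

variable {D : ℕ} (W : ℝ → ℝ → ℝ → ℝ≥0∞)

/-! ### Measurability helpers -/

/-- A polynomial with measurable coefficients is measurable. -/
theorem measurable_pev_coef {α : Type*} [MeasurableSpace α] (c : α → Fin (D + 1) → ℝ)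
    (hc : ∀ l, Measurable fun x => c x l) {e : α → ℝ} (he : Measurable e) :
    Measurable fun x => pev (c x) (e x) := by
  unfold pev
  refine Finset.measurable_sum _ fun l _ => (hc l).mul (he.pow_const _)

/-! ### Splits -/

/-- **Split in the last variable.** -/
theorem split_u_lt_top (hW : Measurable fun p : ℝ × ℝ × ℝ => W p.1 p.2.1 p.2.2)
    (c : ℝ → ℝ → Fin (D + 1) → ℝ) (K : ℝ≥0∞) (hK : K ≠ ∞) (η : ℝ) {A B : Set ℝ}
    (hA : MeasurableSet A) (hB : MeasurableSet B)
    (hmono : ∀ t ∈ A, ∀ v ∈ B, ∀ u u', 0 < u → u ≤ u' → u' ≤ 4 * u → u' < 4 * η →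
      W t v u ≤ K * W t v u')
    (hfin : ∫⁻ t in A, ∫⁻ v in B, ∫⁻ u in Ioo 0 (4 * η),
      ENNReal.ofReal |pev (c t v) u| * W t v u < ∞) (l : Fin (D + 1)) :
    ∫⁻ t in A, ∫⁻ v in B, ∫⁻ u in Ioo 0 η,
      ENNReal.ofReal (|c t v l| * u ^ (l : ℕ)) * W t v u < ∞ := by
  obtain ⟨A₀, hA₀, hsplit⟩ := monoSplit₁_le D
  have hAK : A₀ * K ≠ ∞ := ENNReal.mul_ne_top hA₀ hK
  calc ∫⁻ t in A, ∫⁻ v in B, ∫⁻ u in Ioo 0 η, ENNReal.ofReal (|c t v l| * u ^ (l : ℕ)) * W t v u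
      ≤ ∫⁻ t in A, ∫⁻ v in B, A₀ * K * ∫⁻ u in Ioo 0 (4 * η),
          ENNReal.ofReal |pev (c t v) u| * W t v u :=
        setLIntegral_mono' hA fun t ht => setLIntegral_mono' hB fun v hv =>
          hsplit (c t v) (fun u => W t v u) (measurable_secU W hW t v) K hK η
            (fun u u' hu huu' hu'u hu' => hmono t ht v hv u u' hu huu' hu'u hu') l
    _ = A₀ * K * ∫⁻ t in A, ∫⁻ v in B, ∫⁻ u in Ioo 0 (4 * η),
          ENNReal.ofReal |pev (c t v) u| * W t v u := by
        rw [← lintegral_const_mul' _ _ hAK]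
        refine lintegral_congr fun t => ?_
        rw [← lintegral_const_mul' _ _ hAK]
    _ < ∞ := ENNReal.mul_lt_top hAK.lt_top hfin

/-- **Split in the middle variable.** -/
theorem split_v_lt_top (hW : Measurable fun p : ℝ × ℝ × ℝ => W p.1 p.2.1 p.2.2)
    (c : ℝ → ℝ → Fin (D + 1) → ℝ) (hc : ∀ j, Measurable fun p : ℝ × ℝ => c p.1 p.2 j)
    (K : ℝ≥0∞) (hK : K ≠ ∞) (ε : ℝ) {A C : Set ℝ} (hA : MeasurableSet A) (hC : MeasurableSet C)
    (hmono : ∀ t ∈ A, ∀ u ∈ C, ∀ v v', 0 < v → v ≤ v' → v' ≤ 4 * v → v' < 4 * ε →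
      W t v u ≤ K * W t v' u)
    (hfin : ∫⁻ t in A, ∫⁻ v in Ioo 0 (4 * ε), ∫⁻ u in C,
      ENNReal.ofReal |pev (c t u) v| * W t v u < ∞) (j : Fin (D + 1)) :
    ∫⁻ t in A, ∫⁻ v in Ioo 0 ε, ∫⁻ u in C,
      ENNReal.ofReal (|c t u j| * v ^ (j : ℕ)) * W t v u < ∞ := by
  -- swap the two inner integrals, split in the (now) last variable, swap back
  set F₁ : ℝ × ℝ × ℝ → ℝ≥0∞ := fun p =>
    ENNReal.ofReal (|c p.1 p.2.2 j| * p.2.1 ^ (j : ℕ)) * W p.1 p.2.1 p.2.2 with hF₁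
  set F₂ : ℝ × ℝ × ℝ → ℝ≥0∞ := fun p =>
    ENNReal.ofReal |pev (c p.1 p.2.2) p.2.1| * W p.1 p.2.1 p.2.2 with hF₂
  have h13 : Measurable fun p : ℝ × ℝ × ℝ => (p.1, p.2.2) :=
    measurable_fst.prodMk (measurable_snd.comp measurable_snd)
  have hF₁m : Measurable F₁ := by
    refine Measurable.mul (ENNReal.measurable_ofReal.comp ?_) hW
    exact (((hc j).comp h13).abs).mul ((measurable_fst.comp measurable_snd).pow_const _)
  have hF₂m : Measurable F₂ := by
    refine Measurable.mul (ENNReal.measurable_ofReal.comp ?_) hW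
    exact (measurable_pev_coef (fun p : ℝ × ℝ × ℝ => c p.1 p.2.2) (fun l => (hc l).comp h13)
      (measurable_fst.comp measurable_snd)).abs
  have hperm : Measurable fun p : ℝ × ℝ × ℝ => (p.1, p.2.2, p.2.1) :=
    measurable_fst.prodMk ((measurable_snd.comp measurable_snd).prodMk
      (measurable_fst.comp measurable_snd))
  -- the weight with the two last variables exchanged
  set W' : ℝ → ℝ → ℝ → ℝ≥0∞ := fun t u v => W t v u with hW'
  have hW'm : Measurable fun p : ℝ × ℝ × ℝ => W' p.1 p.2.1 p.2.2 := hW.comp hperm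
  have hfin' : ∫⁻ t in A, ∫⁻ u in C, ∫⁻ v in Ioo 0 (4 * ε),
      ENNReal.ofReal |pev (c t u) v| * W' t u v < ∞ := by
    have h := iter_swap23 F₂ hF₂m A (Ioo 0 (4 * ε)) C
    simp only [hF₂] at h
    rw [← h]
    exact hfin
  have h := split_u_lt_top W' hW'm c K hK ε hA hC
    (fun t ht u hu v v' hv hvv' hv'v hv' => hmono t ht u hu v v' hv hvv' hv'v hv') hfin' j
  have h2 := iter_swap23 F₁ hF₁m A (Ioo 0 ε) C
  simp only [hF₁] at h2
  rw [h2]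
  exact h

/-- **Split in the first variable.** -/
theorem split_t_lt_top (hW : Measurable fun p : ℝ × ℝ × ℝ => W p.1 p.2.1 p.2.2)
    (c : ℝ → ℝ → Fin (D + 1) → ℝ) (hc : ∀ i, Measurable fun p : ℝ × ℝ => c p.1 p.2 i)
    (K : ℝ≥0∞) (hK : K ≠ ∞) (δ : ℝ) {B C : Set ℝ} (hB : MeasurableSet B) (hC : MeasurableSet C)
    (hmono : ∀ v ∈ B, ∀ u ∈ C, ∀ t t', 0 < t → t ≤ t' → t' ≤ 4 * t → t' < 4 * δ →
      W t v u ≤ K * W t' v u)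
    (hfin : ∫⁻ t in Ioo 0 (4 * δ), ∫⁻ v in B, ∫⁻ u in C,
      ENNReal.ofReal |pev (c v u) t| * W t v u < ∞) (i : Fin (D + 1)) :
    ∫⁻ t in Ioo 0 δ, ∫⁻ v in B, ∫⁻ u in C,
      ENNReal.ofReal (|c v u i| * t ^ (i : ℕ)) * W t v u < ∞ := by
  set F₁ : ℝ × ℝ × ℝ → ℝ≥0∞ := fun p =>
    ENNReal.ofReal (|c p.2.1 p.2.2 i| * p.1 ^ (i : ℕ)) * W p.1 p.2.1 p.2.2 with hF₁
  set F₂ : ℝ × ℝ × ℝ → ℝ≥0∞ := fun p =>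
    ENNReal.ofReal |pev (c p.2.1 p.2.2) p.1| * W p.1 p.2.1 p.2.2 with hF₂
  have hF₁m : Measurable F₁ := by
    refine Measurable.mul (ENNReal.measurable_ofReal.comp ?_) hW
    exact (((hc i).comp measurable_snd).abs).mul (measurable_fst.pow_const _)
  have hF₂m : Measurable F₂ := by
    refine Measurable.mul (ENNReal.measurable_ofReal.comp ?_) hW
    exact (measurable_pev_coef (fun p : ℝ × ℝ × ℝ => c p.2.1 p.2.2)
      (fun l => (hc l).comp measurable_snd) measurable_fst).abs
  have hperm : Measurable fun p : ℝ × ℝ × ℝ => (p.2.1, p.1, p.2.2) :=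
    (measurable_fst.comp measurable_snd).prodMk
      (measurable_fst.prodMk (measurable_snd.comp measurable_snd))
  have hrot : Measurable fun p : ℝ × ℝ × ℝ => (p.2.2, p.1, p.2.1) :=
    (measurable_snd.comp measurable_snd).prodMk
      (measurable_fst.prodMk (measurable_fst.comp measurable_snd))
  -- bring `t` innermost: (t, v, u) → (v, t, u) → (v, u, t)
  have hrw : ∀ (F : ℝ × ℝ × ℝ → ℝ≥0∞), Measurable F → ∀ (T : Set ℝ),
      ∫⁻ t in T, ∫⁻ v in B, ∫⁻ u in C, F (t, v, u) = ∫⁻ v in B, ∫⁻ u in C, ∫⁻ t in T, F (t, v, u) := by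
    intro F hF T
    rw [iter_swap12 F hF T B C]
    exact iter_swap23 (fun p : ℝ × ℝ × ℝ => F (p.2.1, p.1, p.2.2)) (hF.comp hperm) B T C
  set W' : ℝ → ℝ → ℝ → ℝ≥0∞ := fun v u t => W t v u with hW'
  have hW'm : Measurable fun p : ℝ × ℝ × ℝ => W' p.1 p.2.1 p.2.2 := hW.comp hrot
  have hfin' : ∫⁻ v in B, ∫⁻ u in C, ∫⁻ t in Ioo 0 (4 * δ),
      ENNReal.ofReal |pev (c v u) t| * W' v u t < ∞ := by
    have h := hrw F₂ hF₂m (Ioo 0 (4 * δ))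
    simp only [hF₂] at h
    rw [← h]
    exact hfin
  have h := split_u_lt_top W' hW'm c K hK δ hB hC
    (fun v hv u hu t t' ht htt' ht't ht' => hmono v hv u hu t t' ht htt' ht't ht') hfin' i
  have h2 := hrw F₁ hF₁m (Ioo 0 δ)
  simp only [hF₁] at h2
  rw [h2]
  exact h

/-! ### Sweeps -/

/-- **Sweep in the last variable**: with a logarithmic cost in `u`, integrability over the
dyadic range `(η/2, η)` gives integrability over `(0, η)`. -/
theorem sweep_u_lt_top (hW : Measurable fun p : ℝ × ℝ × ℝ => W p.1 p.2.1 p.2.2) (Kn : ℕ)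
    (C : ℝ≥0∞) (hC : C ≠ ∞) {η : ℝ} (hη : 0 < η) {A B : Set ℝ} (hA : MeasurableSet A)
    (hB : MeasurableSet B)
    (hulog : ∀ t ∈ A, ∀ v ∈ B, ∀ u u', 0 < u → u ≤ u' → u' < η →
      W t v u ≤ C * ENNReal.ofReal ((1 + Real.log (u' / u)) ^ Kn) * W t v u')
    (F : ℝ → ℝ → ℝ)
    (hfin : ∫⁻ t in A, ∫⁻ v in B, ∫⁻ u in Ioo (η / 2) η, ENNReal.ofReal (F t v) * W t v u < ∞) :
    ∫⁻ t in A, ∫⁻ v in B, ∫⁻ u in Ioo 0 η, ENNReal.ofReal (F t v) * W t v u < ∞ := by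
  set C' : ℝ≥0∞ := C * ENNReal.ofReal (4 * (1 + 2 * Kn) ^ Kn) + 1 with hC'
  have hC'ne : C' ≠ ∞ :=
    ENNReal.add_ne_top.2 ⟨ENNReal.mul_ne_top hC ENNReal.ofReal_ne_top, ENNReal.one_ne_top⟩
  have hpt : ∀ t ∈ A, ∀ v ∈ B, ∫⁻ u in Ioo 0 η, ENNReal.ofReal (F t v) * W t v u ≤
      C' * ∫⁻ u in Ioo (η / 2) η, ENNReal.ofReal (F t v) * W t v u := by
    intro t ht v hv
    have hm := measurable_secU W hW t v
    have h1 := lintegral_le_of_logmono (W t v) hm Kn C hη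
      (fun u u' hu huu' hu' => hulog t ht v hv u u' hu huu' hu')
    rw [lintegral_const_mul' _ _ ENNReal.ofReal_ne_top, lintegral_const_mul' _ _ ENNReal.ofReal_ne_top,
      mul_left_comm]
    exact mul_le_mul_right h1 _
  calc ∫⁻ t in A, ∫⁻ v in B, ∫⁻ u in Ioo 0 η, ENNReal.ofReal (F t v) * W t v u
      ≤ ∫⁻ t in A, ∫⁻ v in B, C' * ∫⁻ u in Ioo (η / 2) η, ENNReal.ofReal (F t v) * W t v u :=
        setLIntegral_mono' hA fun t ht => setLIntegral_mono' hB fun v hv => hpt t ht v hv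
    _ = C' * ∫⁻ t in A, ∫⁻ v in B, ∫⁻ u in Ioo (η / 2) η, ENNReal.ofReal (F t v) * W t v u := by
        rw [← lintegral_const_mul' _ _ hC'ne]
        refine lintegral_congr fun t => ?_
        rw [← lintegral_const_mul' _ _ hC'ne]
    _ < ∞ := ENNReal.mul_lt_top hC'ne.lt_top hfin

/-- **Sweep in the middle variable.** -/
theorem sweep_v_lt_top (hW : Measurable fun p : ℝ × ℝ × ℝ => W p.1 p.2.1 p.2.2) (Kn : ℕ)
    (C : ℝ≥0∞) (hC : C ≠ ∞) {ε : ℝ} (hε : 0 < ε) {A C' : Set ℝ} (hA : MeasurableSet A)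
    (hC' : MeasurableSet C')
    (hvlog : ∀ t ∈ A, ∀ u ∈ C', ∀ v v', 0 < v → v ≤ v' → v' < ε →
      W t v u ≤ C * ENNReal.ofReal ((1 + Real.log (v' / v)) ^ Kn) * W t v' u)
    (F : ℝ → ℝ → ℝ) (hF : Measurable (Function.uncurry F))
    (hfin : ∫⁻ t in A, ∫⁻ v in Ioo (ε / 2) ε, ∫⁻ u in C', ENNReal.ofReal (F t u) * W t v u < ∞) :
    ∫⁻ t in A, ∫⁻ v in Ioo 0 ε, ∫⁻ u in C', ENNReal.ofReal (F t u) * W t v u < ∞ := by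
  set G : ℝ × ℝ × ℝ → ℝ≥0∞ := fun p => ENNReal.ofReal (F p.1 p.2.2) * W p.1 p.2.1 p.2.2 with hG
  have h13 : Measurable fun p : ℝ × ℝ × ℝ => (p.1, p.2.2) :=
    measurable_fst.prodMk (measurable_snd.comp measurable_snd)
  have hGm : Measurable G := (ENNReal.measurable_ofReal.comp (hF.comp h13)).mul hW
  have hperm : Measurable fun p : ℝ × ℝ × ℝ => (p.1, p.2.2, p.2.1) :=
    measurable_fst.prodMk ((measurable_snd.comp measurable_snd).prodMk
      (measurable_fst.comp measurable_snd))
  set W' : ℝ → ℝ → ℝ → ℝ≥0∞ := fun t u v => W t v u with hW'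
  have hW'm : Measurable fun p : ℝ × ℝ × ℝ => W' p.1 p.2.1 p.2.2 := hW.comp hperm
  have hfin' : ∫⁻ t in A, ∫⁻ u in C', ∫⁻ v in Ioo (ε / 2) ε, ENNReal.ofReal (F t u) * W' t u v < ∞ := by
    have h := iter_swap23 G hGm A (Ioo (ε / 2) ε) C'
    simp only [hG] at h
    rw [← h]
    exact hfin
  have h := sweep_u_lt_top W' hW'm Kn C hC hε hA hC'
    (fun t ht u hu v v' hv hvv' hv' => hvlog t ht u hu v v' hv hvv' hv') F hfin'
  have h2 := iter_swap23 G hGm A (Ioo 0 ε) C'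
  simp only [hG] at h2
  rw [h2]
  exact h

/-! ### Lower bounds on sub-boxes -/

/-- **A lower bound on a sub-box.** If `h ≤ |H v u|` on `B₂ × C₂` (`h > 0`), then the
integrability of `|H| F · W` over `A × B × C` gives that of `F · W` over `A × B₂ × C₂`. -/
theorem lower_box_lt_top {A B C B₂ C₂ : Set ℝ} (hA : MeasurableSet A) (hB₂ : MeasurableSet B₂)
    (hC₂ : MeasurableSet C₂) (hBB : B₂ ⊆ B) (hCC : C₂ ⊆ C) (H : ℝ → ℝ → ℝ) (F : ℝ → ℝ)
    (hF : ∀ t ∈ A, 0 ≤ F t) {h : ℝ} (hh : 0 < h) (hle : ∀ v ∈ B₂, ∀ u ∈ C₂, h ≤ |H v u|)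
    (hfin : ∫⁻ t in A, ∫⁻ v in B, ∫⁻ u in C, ENNReal.ofReal (|H v u| * F t) * W t v u < ∞) :
    ∫⁻ t in A, ∫⁻ v in B₂, ∫⁻ u in C₂, ENNReal.ofReal (F t) * W t v u < ∞ := by
  have hpt : ∀ t ∈ A, ∀ v ∈ B₂, ∀ u ∈ C₂, ENNReal.ofReal (F t) * W t v u ≤
      ENNReal.ofReal h⁻¹ * (ENNReal.ofReal (|H v u| * F t) * W t v u) := by
    intro t ht v hv u hu
    rw [← mul_assoc, ← ENNReal.ofReal_mul (inv_nonneg.2 hh.le)]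
    refine mul_le_mul_left (ENNReal.ofReal_le_ofReal ?_) _
    have h1 : 1 ≤ h⁻¹ * |H v u| := by
      rw [le_inv_mul_iff₀ hh, mul_one]; exact hle v hv u hu
    calc F t = 1 * F t := (one_mul _).symm
      _ ≤ h⁻¹ * |H v u| * F t := mul_le_mul_of_nonneg_right h1 (hF t ht)
      _ = h⁻¹ * (|H v u| * F t) := by ring
  calc ∫⁻ t in A, ∫⁻ v in B₂, ∫⁻ u in C₂, ENNReal.ofReal (F t) * W t v u
      ≤ ∫⁻ t in A, ∫⁻ v in B₂, ∫⁻ u in C₂,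
          ENNReal.ofReal h⁻¹ * (ENNReal.ofReal (|H v u| * F t) * W t v u) :=
        iter_mono hA hB₂ hC₂ hpt
    _ = ENNReal.ofReal h⁻¹ * ∫⁻ t in A, ∫⁻ v in B₂, ∫⁻ u in C₂,
          ENNReal.ofReal (|H v u| * F t) * W t v u := by
        rw [← lintegral_const_mul' _ _ ENNReal.ofReal_ne_top]
        refine lintegral_congr fun t => ?_
        rw [← lintegral_const_mul' _ _ ENNReal.ofReal_ne_top]
        refine lintegral_congr fun v => ?_
        rw [← lintegral_const_mul' _ _ ENNReal.ofReal_ne_top]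
    _ ≤ ENNReal.ofReal h⁻¹ * ∫⁻ t in A, ∫⁻ v in B, ∫⁻ u in C,
          ENNReal.ofReal (|H v u| * F t) * W t v u := by
        refine mul_le_mul_right (lintegral_mono fun t => ?_) _
        exact (lintegral_mono_set hBB).trans (lintegral_mono fun v => lintegral_mono_set hCC)
    _ < ∞ := ENNReal.mul_lt_top ENNReal.ofReal_lt_top hfin

end SepHHK

/-- **Split in the first variable of a triple integral** (registered part of
`stub_separateHigh`, base dimension `3` with fibres; literal form of `SepHHK.split_t_lt_top`): if a
polynomial in `t` whose coefficients depend measurably on `(v, u)` is absolutely integrable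
against a jointly measurable weight that is almost decreasing towards `t → 0` at ratio `4`, over
`(0, 4δ) × B × C`, then every monomial `c v u i · t^i` is, over `(0, δ) × B × C`. -/
theorem separateThreeHHK_split (D : ℕ) (W : ℝ → ℝ → ℝ → ENNReal) (hW : Measurable fun p : ℝ × ℝ × ℝ => W p.1 p.2.1 p.2.2) (c : ℝ → ℝ → Fin (D + 1) → ℝ) (hc : ∀ i, Measurable fun p : ℝ × ℝ => c p.1 p.2 i) (K : ENNReal) (hK : K ≠ ⊤) (δ : ℝ) (B C : Set ℝ) (hB : MeasurableSet B) (hC : MeasurableSet C) (hmono : ∀ v ∈ B, ∀ u ∈ C, ∀ t t' : ℝ, 0 < t → t ≤ t' → t' ≤ 4 * t → t' < 4 * δ → W t v u ≤ K * W t' v u) (hfin : MeasureTheory.lintegral (MeasureTheory.volume.restrict (Set.Ioo 0 (4 * δ))) (fun t => MeasureTheory.lintegral (MeasureTheory.volume.restrict B) (fun v => MeasureTheory.lintegral (MeasureTheory.volume.restrict C) (fun u => ENNReal.ofReal |∑ i' : Fin (D + 1), c v u i' * t ^ (i' : ℕ)| * W t v u))) < ⊤) (i : Fin (D + 1)) :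 MeasureTheory.lintegral (MeasureTheory.volume.restrict (Set.Ioo 0 δ)) (fun t => MeasureTheory.lintegral (MeasureTheory.volume.restrict B) (fun v => MeasureTheory.lintegral (MeasureTheory.volume.restrict C) (fun u => ENNReal.ofReal (|c v u i| * t ^ (i : ℕ)) * W t v u))) < ⊤ := by
  exact SepHHK.split_t_lt_top W hW c hc K hK δ hB hC hmono hfin i

end Summit.KontsevichZagierPeriods.ArrangementNormalForm.JanusBands
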